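import Summits.BirchSwinnertonDyer.BirchSwinnertonDyer.Theorems.CMKolyvaginAtInertTwoPairCurrencyAtTwo
import HarnessLib

/-!
# Route `CMKolyvaginAtInertTwo`, crux `CMKolyvaginExactAtInertTwo` (stmt-BirchSwinnertonDyer-24277):
# RESTRICTING McCallum's descent data — fewer Kolyvagin primes, a smaller Selmer group cut out by
# smaller local conditions away from the Kolyvagin places (the carrier of `pairDataQ`)

Seat `bsd-line-cmk2-p1` g14 (cell `bsd-print-cf2`); helper (`--supports stmt-BirchSwinnertonDyer-24277`).
ONE DEFINITION (`restrictData`, pure bookkeeping on the Literature carrier `KolyvaginDescent.SplitDataM`)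
and its `rfl`-API; no named fact, no `sorry`; no item is closed; BSD is not proved by this.

The T2 design (KERNEL-STATUS §13.2, §13.7) runs the adaptive telescope
(`card_mul_card_le_two_pow_of_pair_succ`, p688445) on the `ℚ`-SELMER SUB-CARRIER of the pair data
`pairData` (p675421): the SAME classes `x`, `c(n)`, eigengroups, strict conditions `A ℓ` and places,
but (i) FEWER Kolyvagin primes (`Kol' ⊆ Kol`: Gross-form of depth `M+1` instead of `M`) and (ii) a
SMALLER Selmer group, cut out by smaller local conditions `Loc' v ≤ Loc v` at places `v` that are
never the place `pl ℓ` of a new Kolyvagin prime (the ramified `𝔮 ∣ d_K`, shrunk by the descent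
condition). `restrictData` packages this once and for all: the only obligations left are that the
new Selmer group is split (automatic on the pair: `pair_split_of_prod`), and that `x` and the
classes `c(n)` (`n` a square-free product of NEW Kolyvagin primes, `v ∤ n`) satisfy the new local
conditions where they differ from the old ones — the arithmetic input (for `pairDataQ`: McCallum
Lemma 4.6 one level deeper, `Literature…KolyvaginClassLevelChange`). Everything else (torsion,
`eig_disjoint`, `dv_iff`, `dv_mul`, `x_ord`, `c_one`, Gross Prop. 5.4 (2) `c_eig`, Lemma 4.3
`c_mem_loc` at unchanged places, Prop. 4.4 `c_mem_loc_iff` at `pl ℓ`) is inherited.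

* `kolSupp_of_imp` — `KolSupp` is monotone in the set of Kolyvagin primes;
* `restrictData` — the constructor; `restrictData_p/M/eig/Loc/Kol/pl/Dv/A/x/M₀/ε/c/expo` (`rfl`),
  `mem_restrictData_sel_iff`, `restrictData_sel_le`;
* `pair_split_of_prod` — on `V = V^{ε} × V^{−ε}` a Selmer group cut out by PRODUCT local conditions
  is split for `eig = pairEig`.

References: [McCallumLMS1991] §4 (Lemma 4.3, Prop. 4.4, Lemma 4.6), §5 (Thm. 5.4: the induction
runs inside any Selmer group containing `x` and stable under the classes); [Kolyvagin1989Izv] §3.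
-/

-- single-conjunct summit: `Summit.BirchSwinnertonDyer.BirchSwinnertonDyer.…` repeats the name by design
set_option linter.dupNamespace false
set_option autoImplicit false

noncomputable section

open scoped Classical
open WeierstrassCurve NumberField
open Literature.NumberTheory.GaloisRepresentations
open Literature.NumberTheory.EllipticCurves Literature.NumberTheory.EllipticCurves.KolyvaginDescent

namespace Summit.BirchSwinnertonDyer.BirchSwinnertonDyer.Theorems.KolyvaginPairDataTwo

section Generic

variable {V : Type*} [AddCommGroup V] {Pl : Type*}

/-- `KolSupp` is monotone in the set of Kolyvagin primes. [folklore] -/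
theorem kolSupp_of_imp {Kol Kol' : ℕ → Prop} (h : ∀ ℓ, Kol' ℓ → Kol ℓ) {n : ℕ}
    (hn : KolSupp Kol' n) : KolSupp Kol n :=
  ⟨hn.1, fun q hq ↦ h q (hn.2 q hq)⟩

/-- **McCallum's descent data restricted**: the same prime, level, eigengroups, places, strict
conditions, Heegner class `x`, `M₀`, sign and classes `c(n)` as `Sd`, with FEWER Kolyvagin primes
`Kol' ⊆ Sd.Kol` and the NEW Selmer group `{s | ∀ v, s ∈ Loc' v}` cut out by local conditions `Loc' v`
(smaller ones in the application, `restrictData_sel_le`) which agree with `Sd.Loc` at the places of the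
new Kolyvagin primes. Obligations:
the new Selmer group is split (`hsplit`); `x ∈ Loc' v` and `c(n) ∈ Loc' v` (`n` a square-free product
of new Kolyvagin primes, `v ∤ n`) at the places where `Loc'` differs from `Sd.Loc`.
[cite: McCallumLMS1991, §5 Thm. 5.4 (the induction inside a Selmer group); §4 Lemma 4.3, Prop. 4.4] -/
def restrictData (Sd : SplitDataM V Pl) (Kol' : ℕ → Prop) (hKol : ∀ ℓ, Kol' ℓ → Sd.Kol ℓ)
    (Loc' : Pl → AddSubgroup V)
    (hpl : ∀ ℓ, Kol' ℓ → Loc' (Sd.pl ℓ) = Sd.Loc (Sd.pl ℓ))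
    (hsplit : ∀ s : V, (∀ v, s ∈ Loc' v) → ∃ s₁ s₂ : V,
      ((∀ v, s₁ ∈ Loc' v) ∧ s₁ ∈ Sd.eig 1) ∧ ((∀ v, s₂ ∈ Loc' v) ∧ s₂ ∈ Sd.eig (-1)) ∧ s = s₁ + s₂)
    (hx : ∀ v, Loc' v ≠ Sd.Loc v → Sd.x ∈ Loc' v)
    (hc : ∀ n, KolSupp Kol' n → ∀ v, ¬ Sd.Dv v n → Loc' v ≠ Sd.Loc v → Sd.c n ∈ Loc' v) :
    SplitDataM V Pl where
  p := Sd.p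
  hp := Sd.hp
  M := Sd.M
  torsion := Sd.torsion
  eig := Sd.eig
  eig_disjoint := Sd.eig_disjoint
  Sel :=
    { carrier := {s | ∀ v, s ∈ Loc' v}
      zero_mem' := fun v ↦ zero_mem _
      add_mem' := fun ha hb v ↦ add_mem (ha v) (hb v)
      neg_mem' := fun ha v ↦ neg_mem (ha v) }
  sel_split := fun s hs ↦ hsplit s hs
  Loc := Loc'
  mem_sel_iff := fun _ ↦ Iff.rfl
  Kol := Kol'
  prime_of_kol := fun ℓ h ↦ Sd.prime_of_kol ℓ (hKol ℓ h)
  pl := Sd.pl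
  Dv := Sd.Dv
  dv_iff := fun ℓ h ↦ Sd.dv_iff ℓ (hKol ℓ h)
  dv_mul := fun ℓ ℓ' h h' ↦ Sd.dv_mul ℓ ℓ' (hKol ℓ h) (hKol ℓ' h')
  A := Sd.A
  x := Sd.x
  x_mem := fun v ↦ by
    by_cases h : Loc' v = Sd.Loc v
    · rw [h]
      exact (Sd.mem_sel_iff Sd.x).mp Sd.x_mem v
    · exact hx v h
  x_ord := Sd.x_ord
  M₀ := Sd.M₀
  ε := Sd.ε
  hε := Sd.hε
  x_eig := Sd.x_eig
  c := Sd.c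
  c_one := Sd.c_one
  c_eig := fun n hn ↦ Sd.c_eig n (kolSupp_of_imp hKol hn)
  c_mem_loc := fun n hn v hv ↦ by
    by_cases h : Loc' v = Sd.Loc v
    · rw [h]
      exact Sd.c_mem_loc n (kolSupp_of_imp hKol hn) v hv
    · exact hc n hn v hv h
  c_mem_loc_iff := fun ℓ m hℓ hℓm a ↦ by
    rw [hpl ℓ hℓ]
    exact Sd.c_mem_loc_iff ℓ m (hKol ℓ hℓ) (kolSupp_of_imp hKol hℓm) a

section API

variable (Sd : SplitDataM V Pl) (Kol' : ℕ → Prop) (hKol : ∀ ℓ, Kol' ℓ → Sd.Kol ℓ)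
    (Loc' : Pl → AddSubgroup V)
    (hpl : ∀ ℓ, Kol' ℓ → Loc' (Sd.pl ℓ) = Sd.Loc (Sd.pl ℓ))
    (hsplit : ∀ s : V, (∀ v, s ∈ Loc' v) → ∃ s₁ s₂ : V,
      ((∀ v, s₁ ∈ Loc' v) ∧ s₁ ∈ Sd.eig 1) ∧ ((∀ v, s₂ ∈ Loc' v) ∧ s₂ ∈ Sd.eig (-1)) ∧ s = s₁ + s₂)
    (hx : ∀ v, Loc' v ≠ Sd.Loc v → Sd.x ∈ Loc' v)
    (hc : ∀ n, KolSupp Kol' n → ∀ v, ¬ Sd.Dv v n → Loc' v ≠ Sd.Loc v → Sd.c n ∈ Loc' v)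

/-- Same prime. [folklore] -/
@[simp] theorem restrictData_p : (restrictData Sd Kol' hKol Loc' hpl hsplit hx hc).p = Sd.p := rfl

/-- Same level. [folklore] -/
@[simp] theorem restrictData_M : (restrictData Sd Kol' hKol Loc' hpl hsplit hx hc).M = Sd.M := rfl

/-- Same eigengroups. [folklore] -/
@[simp] theorem restrictData_eig : (restrictData Sd Kol' hKol Loc' hpl hsplit hx hc).eig = Sd.eig := rfl

/-- The new local conditions. [folklore] -/
@[simp] theorem restrictData_loc : (restrictData Sd Kol' hKol Loc' hpl hsplit hx hc).Loc = Loc' := rfl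

/-- The new Kolyvagin primes. [folklore] -/
@[simp] theorem restrictData_kol : (restrictData Sd Kol' hKol Loc' hpl hsplit hx hc).Kol = Kol' := rfl

/-- Same places of Kolyvagin primes. [folklore] -/
@[simp] theorem restrictData_pl : (restrictData Sd Kol' hKol Loc' hpl hsplit hx hc).pl = Sd.pl := rfl

/-- Same divisibility relation. [folklore] -/
@[simp] theorem restrictData_dv : (restrictData Sd Kol' hKol Loc' hpl hsplit hx hc).Dv = Sd.Dv := rfl

/-- Same strict conditions. [folklore] -/
@[simp] theorem restrictData_A : (restrictData Sd Kol' hKol Loc' hpl hsplit hx hc).A = Sd.A := rfl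

/-- Same Heegner class. [folklore] -/
@[simp] theorem restrictData_x : (restrictData Sd Kol' hKol Loc' hpl hsplit hx hc).x = Sd.x := rfl

/-- Same `M₀`. [folklore] -/
@[simp] theorem restrictData_M₀ : (restrictData Sd Kol' hKol Loc' hpl hsplit hx hc).M₀ = Sd.M₀ := rfl

/-- Same sign. [folklore] -/
@[simp] theorem restrictData_ε : (restrictData Sd Kol' hKol Loc' hpl hsplit hx hc).ε = Sd.ε := rfl

/-- Same classes. [folklore] -/
@[simp] theorem restrictData_c : (restrictData Sd Kol' hKol Loc' hpl hsplit hx hc).c = Sd.c := rfl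

/-- Same exponents `ord s = p^{expo s}`. [folklore] -/
@[simp] theorem restrictData_expo :
    (restrictData Sd Kol' hKol Loc' hpl hsplit hx hc).expo = Sd.expo := rfl

/-- Membership in the new Selmer group: all the new local conditions. [cite: McCallumLMS1991, §4] -/
theorem mem_restrictData_sel_iff (s : V) :
    s ∈ (restrictData Sd Kol' hKol Loc' hpl hsplit hx hc).Sel ↔ ∀ v, s ∈ Loc' v :=
  Iff.rfl

/-- The new Selmer group is contained in the old one when the local conditions are smaller.
[cite: McCallumLMS1991, §4] -/
theorem restrictData_sel_le (hLoc : ∀ v, Loc' v ≤ Sd.Loc v) :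
    (restrictData Sd Kol' hKol Loc' hpl hsplit hx hc).Sel ≤ Sd.Sel := by
  intro s hs
  rw [mem_restrictData_sel_iff] at hs
  exact (Sd.mem_sel_iff s).mpr fun v ↦ hLoc v (hs v)

/-- New Kolyvagin-supported levels are old ones. [folklore] -/
theorem kolSupp_of_restrictData {n : ℕ}
    (hn : KolSupp (restrictData Sd Kol' hKol Loc' hpl hsplit hx hc).Kol n) : KolSupp Sd.Kol n :=
  kolSupp_of_imp hKol hn

end API

end Generic

/-! ## On the pair: product local conditions are split -/

variable (W : WeierstrassCurve ℚ) {K : Type} [Field K] [NumberField K] (c : K ≃ₐ[ℚ] K) (M : ℕ)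

/-- **Product local conditions on `V = V^{ε} × V^{−ε}` cut out a SPLIT Selmer group** for the
eigengroups `pairEig ε (±1)`: `s = (s.1, 0) + (0, s.2)`. [cite: Kolyvagin1989Izv, §3] -/
theorem pair_split_of_prod {ε : ℤ} (hε : ε = 1 ∨ ε = -1) {Pl : Type*}
    (L₁ : Pl → AddSubgroup ↥(eigK W c M ε)) (L₂ : Pl → AddSubgroup ↥(eigK W c M (-ε)))
    (s : PairV W c M ε) (hs : ∀ v, s ∈ (L₁ v).prod (L₂ v)) :
    ∃ s₁ s₂ : PairV W c M ε,
      ((∀ v, s₁ ∈ (L₁ v).prod (L₂ v)) ∧ s₁ ∈ pairEig W c M ε 1) ∧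
      ((∀ v, s₂ ∈ (L₁ v).prod (L₂ v)) ∧ s₂ ∈ pairEig W c M ε (-1)) ∧ s = s₁ + s₂ := by
  have h1 : ∀ v, ((s.1, 0) : PairV W c M ε) ∈ (L₁ v).prod (L₂ v) := fun v ↦
    AddSubgroup.mem_prod.mpr ⟨(AddSubgroup.mem_prod.mp (hs v)).1, zero_mem _⟩
  have h2 : ∀ v, ((0, s.2) : PairV W c M ε) ∈ (L₁ v).prod (L₂ v) := fun v ↦
    AddSubgroup.mem_prod.mpr ⟨zero_mem _, (AddSubgroup.mem_prod.mp (hs v)).2⟩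
  have hsum : s = (s.1, 0) + (0, s.2) :=
    Prod.ext (by simp only [Prod.fst_add, add_zero]) (by simp only [Prod.snd_add, zero_add])
  rcases hε with hε1 | hε1
  · refine ⟨(s.1, 0), (0, s.2), ⟨h1, ?_⟩, ⟨h2, ?_⟩, hsum⟩
    · rw [pairEig, if_pos hε1.symm, AddSubgroup.mem_prod]
      exact ⟨AddSubgroup.mem_top _, AddSubgroup.mem_bot.mpr rfl⟩
    · have hne : (-1 : ℤ) ≠ ε := by rw [hε1]; decide
      have heq : (-1 : ℤ) = -ε := by rw [hε1]
      rw [pairEig, if_neg hne, if_pos heq, AddSubgroup.mem_prod]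
      exact ⟨AddSubgroup.mem_bot.mpr rfl, AddSubgroup.mem_top _⟩
  · refine ⟨(0, s.2), (s.1, 0), ⟨h2, ?_⟩, ⟨h1, ?_⟩, by rw [add_comm]; exact hsum⟩
    · have hne : (1 : ℤ) ≠ ε := by rw [hε1]; decide
      have heq : (1 : ℤ) = -ε := by rw [hε1]; decide
      rw [pairEig, if_neg hne, if_pos heq, AddSubgroup.mem_prod]
      exact ⟨AddSubgroup.mem_bot.mpr rfl, AddSubgroup.mem_top _⟩
    · rw [pairEig, if_pos hε1.symm, AddSubgroup.mem_prod]
      exact ⟨AddSubgroup.mem_top _, AddSubgroup.mem_bot.mpr rfl⟩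

end Summit.BirchSwinnertonDyer.BirchSwinnertonDyer.Theorems.KolyvaginPairDataTwo

end
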